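import Summits.Parity.GeneralizedHardyLittlewood.Theorems.BeyondDiagonalBeatsQuarter.CleanScales
import Literature.NumberTheory.LFunctions.ExceptionalZeroFromSmallLOneProofs
import Literature.NumberTheory.Sieve.MontgomeryVaughan1975Zeros
import HarnessLib

/-!
# Route `PrimeLevelFamEdge` — TYPED IDEA DELTAS, deck 28b (LANDING NOTE typer ls-idea-typ-1 gen 4: the seat's
# `HOME/ls-idea-lens-7/Sketch_Uter_SmallLOneWindowClean.lean` sha16 05f91625d19e04a2 VERBATIM up to namespace
# `…BeyondDiagonalBeatsQuarter.OffDiag.LensSevenSketchUter` → `…PrimeLevelFamEdgeIdeaDeltas.ExcZeroLedgerWindow`; landed as offered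
# (lens-7 v2.3 VTM; critic of record D b120 PASS: byte-copy rc 0, axioms std), companion of deck 28 `…ExcZeroLedger`; `ne_one_of_isPrimitive` PRIVATE — dedup: it is
# the tree's `Literature.NumberTheory.LFunctions.LFDSingle.ne_one_of_isPrimitive'`; the K_B namespace is `open`ed for `CleanScale`.)
#
# Sketch (cell ls-idea, seat lens-7 = I7-DEURING–HEILBRONN, gen 28) — crux idea
# `l7-exceptional-clause-two-term-ledger` on K_B `stmt-Parity-20343` (`stub_offDiagBelowSlack_io`, line
# `diagonal_kernel_split` REV 4), §U v2.0 pieces **U-B** and **U-D**: typed → PROVED (tree theorems only)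

OMEGA-BLUEPRINT node **L5′ `OffDiagTransition` ≡ U**, row (S) a8S-short («conductors ≤ N^{3η}»), world (A).

The §U ledger of the idea card (v2.0, `Sketch_U_ExcWorldLedger.lean` sha16 7478f05b873579d8) typed five
first-lemma signatures U-A … U-E.  U-A's quantitative form landed as deck 28
(`Theorems/PrimeLevelFamEdgeIdeaDeltasExcZeroLedger.lean`, p653994).  This file restates **U-B**
(`SmallLOneForcesRealZero`) and **U-D** (`DHWindowClean`) VERBATIM from that sketch and PROVES both, sorry-free,
as corollaries of two theorems already PROVED in the tree:

* `Literature.NumberTheory.LFunctions.montgomeryVaughan2007_theorem114_dichotomy_holds` — Montgomery–Vaughan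
  2007 Theorem 11.4 at `s = 1` (the dichotomy `L(1,χ) ≥ c₁/log 4q` or a real zero `β < 1` with
  `1 − β ≤ C·L(1,χ)`) [cite: MontgomeryVaughan2007, §11.1 Theorem 11.4 (11.7) (11.10)];
* `Literature.NumberTheory.Sieve.MontgomeryVaughan1975.exists_exceptionalZero_unique` — Page's theorem /
  uniqueness of the exceptional zero relative to a level `T ≥ 4` [cite: MontgomeryVaughan2007, Corollary 11.10;
  MontgomeryVaughanActa1975, §4 Lemma 4.1].

Bookkeeping only: `log 4D ≤ 3 log D` (`D ≥ 2`) converts the `1/log 4q` threshold into the card's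
`‖L(1,χ)‖·log D ≤ c₀` with `c₀ = c₁/4`; for U-D the Page level is `T = D²` and the card's window hypotheses
`D^{θ/2} ≤ N`, `N^{η′} < D` put every conductor `D′ ≤ N^{η′}` strictly below the exceptional modulus `D` while
the clean-scale threshold `1 − (c_U θ/4)/log N ≥ 1 − c_U/(2 log D)` stays inside the Page region
(`c_U = c/2`, `c` the constant of `exists_exceptionalZero_unique`).  The hypotheses `θη′ ≤ 2`, `N ≤ D^θ` and
`χ.IsQuadratic` of the verbatim signature are not needed.

HONESTY.  No exceptional-zero theorem is proved by ideation: U-B is Hecke–Landau/MV 11.4 repackaged (already a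
tree theorem), U-D takes the exceptional zero as a HYPOTHESIS.  Neither touches the heart stub; they move two of
the five §U pieces from «typed» to «PROVED», leaving U-C (logic + finiteness) typed and U-E (= the crux clause at
node U) open.
-/

noncomputable section

open Real

namespace Summit.Parity.GeneralizedHardyLittlewood.Theorems.PrimeLevelFamEdgeIdeaDeltas.ExcZeroLedgerWindow

open Summit.Parity.GeneralizedHardyLittlewood.Theorems.BeyondDiagonalBeatsQuarter

open Literature.NumberTheory.LFunctions

/-- **(U-B) verbatim from §U v2.0** (`Sketch_U_ExcWorldLedger.lean` 7478f05b873579d8): a small `L(1,χ)`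
forces a real zero within `C·L(1,χ)` of `1`. -/
def SmallLOneForcesRealZero : Prop :=
  ∃ C c₀ : ℝ, 0 < C ∧ 0 < c₀ ∧ ∀ (D : ℕ) [NeZero D] (χ : DirichletCharacter ℂ D),
    3 ≤ D → χ.IsQuadratic → χ.IsPrimitive → ‖χ.LFunction 1‖ * Real.log D ≤ c₀ →
      ∃ β : ℝ, 1 - C * ‖χ.LFunction 1‖ ≤ β ∧ β < 1 ∧ χ.LFunction β = 0

/-- **(U-D) verbatim from §U v2.0** (`Sketch_U_ExcWorldLedger.lean` 7478f05b873579d8): every scale of the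
DH window below the exceptional modulus is clean. -/
def DHWindowClean : Prop :=
  ∃ c_U : ℝ, 0 < c_U ∧ ∀ (η' θ : ℝ), 0 < η' → 0 < θ → θ * η' ≤ 2 →
    ∀ (D : ℕ) [NeZero D] (χ : DirichletCharacter ℂ D) (β : ℝ), χ.IsQuadratic → χ.IsPrimitive →
      1 - c_U / Real.log ((D : ℝ) ^ 2) ≤ β → β < 1 → χ.LFunction β = 0 →
      ∀ N : ℕ, 2 ≤ N → (N : ℝ) ^ η' < D → (N : ℝ) ≤ (D : ℝ) ^ θ → (D : ℝ) ^ (θ / 2) ≤ N →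
        CleanScale (c_U * θ / 4) η' N

/-- A primitive character to a modulus `> 1` is not the trivial character (the conductor of `1` is `1`).
[folklore; Mathlib `DirichletCharacter.conductor_one`] -/
private theorem ne_one_of_isPrimitive {D : ℕ} [NeZero D] {χ : DirichletCharacter ℂ D}
    (hχ : χ.IsPrimitive) (hD : 1 < D) : χ ≠ 1 := by
  rintro rfl
  rw [DirichletCharacter.isPrimitive_def, DirichletCharacter.conductor_one] at hχ
  omega

/-- Bookkeeping: `log 4D ≤ 3 log D` for `D ≥ 2` (`4D ≤ D³`). [folklore] -/
theorem log_four_mul_le {D : ℕ} (hD : 2 ≤ D) : Real.log (4 * D) ≤ 3 * Real.log D := by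
  have hD' : (2 : ℝ) ≤ D := by exact_mod_cast hD
  have hD0 : (0 : ℝ) < D := by linarith
  have h3 : (3 : ℝ) * Real.log D = Real.log ((D : ℝ) ^ 3) := by
    rw [Real.log_pow]; norm_num
  rw [h3]
  refine Real.log_le_log (by positivity) ?_
  have h4 : (4 : ℝ) ≤ (D : ℝ) ^ 2 := by nlinarith
  calc (4 : ℝ) * D ≤ (D : ℝ) ^ 2 * D := mul_le_mul_of_nonneg_right h4 hD0.le
    _ = (D : ℝ) ^ 3 := by ring

/-- **U-B PROVED** from Montgomery–Vaughan Theorem 11.4 at `s = 1` (tree theorem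
`montgomeryVaughan2007_theorem114_dichotomy_holds`), with `C` the dichotomy constant and `c₀ = c₁/4`.
[cite: MontgomeryVaughan2007, §11.1 Theorem 11.4 (11.7) (11.10)] -/
theorem smallLOneForcesRealZero_holds : SmallLOneForcesRealZero := by
  obtain ⟨c₁, C, hc₁, hC, h⟩ := montgomeryVaughan2007_theorem114_dichotomy_holds
  refine ⟨C, c₁ / 4, hC, by positivity, ?_⟩
  intro D _ χ hD _hquad hprim hsmall
  have hD2 : 2 ≤ D := le_trans (by norm_num) hD
  have hDr : (3 : ℝ) ≤ D := by exact_mod_cast hD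
  have hlogD : 0 < Real.log D := Real.log_pos (by linarith)
  have hχ : χ ≠ 1 := ne_one_of_isPrimitive hprim (by omega)
  rcases h D χ hD2 hχ with hbig | ⟨β, hβ1, hβC, hβ0⟩
  · exfalso
    have hlog4D0 : 0 < Real.log (4 * D) := Real.log_pos (by linarith)
    have h3 : c₁ / (3 * Real.log D) ≤ ‖χ.LFunction 1‖ :=
      le_trans (div_le_div_of_nonneg_left hc₁.le hlog4D0 (log_four_mul_le hD2)) hbig
    have e : c₁ / (3 * Real.log D) * Real.log D = c₁ / 3 := by
      rw [div_mul_eq_mul_div, mul_div_mul_right _ _ hlogD.ne']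
    have h4 : c₁ / 3 ≤ ‖χ.LFunction 1‖ * Real.log D := by
      rw [← e]; exact mul_le_mul_of_nonneg_right h3 hlogD.le
    linarith
  · exact ⟨β, by linarith, hβ1, hβ0⟩

/-- **U-D PROVED** from Page's theorem (tree theorem `MontgomeryVaughan1975.exists_exceptionalZero_unique`,
level `T = D²`), with `c_U = c/2`. [cite: MontgomeryVaughan2007, Corollary 11.10;
MontgomeryVaughanActa1975, §4 Lemma 4.1] -/
theorem dhWindowClean_holds : DHWindowClean := by
  obtain ⟨c, hc, hP⟩ := Literature.NumberTheory.Sieve.MontgomeryVaughan1975.exists_exceptionalZero_unique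
  refine ⟨c / 2, by positivity, ?_⟩
  intro η' θ hη' hθ _hθη D _ χ β _hquad hprim hβlo hβ1 hβ0 N hN hNη _hNθ hDN
  -- sizes
  have hN2 : (2 : ℝ) ≤ N := by exact_mod_cast hN
  have hNη1 : (1 : ℝ) < (N : ℝ) ^ η' := Real.one_lt_rpow (by linarith) hη'
  have hD1r : (1 : ℝ) < D := lt_trans hNη1 hNη
  have hD1 : 1 < D := by exact_mod_cast hD1r
  have hD2r : (2 : ℝ) ≤ D := by exact_mod_cast (Nat.succ_le_of_lt hD1)
  have hD0 : (0 : ℝ) < D := by linarith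
  have hlogD : 0 < Real.log D := Real.log_pos hD1r
  have hL0 : Real.log D ≠ 0 := hlogD.ne'
  have hlogN : 0 < Real.log N := Real.log_pos (by linarith)
  -- the Page level `T = D²`
  have hT4 : (4 : ℝ) ≤ (D : ℝ) ^ 2 := by nlinarith
  have hlogT : Real.log ((D : ℝ) ^ 2) = 2 * Real.log D := by rw [Real.log_pow]; norm_num
  have hDT : (D : ℝ) ≤ (D : ℝ) ^ 2 := by nlinarith
  obtain ⟨hreal, huniq⟩ := hP ((D : ℝ) ^ 2) hT4
  have hχ : χ ≠ 1 := ne_one_of_isPrimitive hprim hD1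
  -- the exceptional zero `β` lies in the Page region for `T = D²`
  have hβT : 1 - c / Real.log ((D : ℝ) ^ 2) < β := by
    rw [hlogT] at hβlo ⊢
    have hgap : c / (2 * Real.log D) - c / 2 / (2 * Real.log D) = c / (4 * Real.log D) := by
      field_simp; ring
    have hpos : 0 < c / (4 * Real.log D) := by positivity
    linarith
  have hχsq : χ ^ 2 = 1 :=
    (hreal D χ hχ hDT (β : ℂ) hβ0 (by simp only [Complex.ofReal_im, abs_zero]; linarith)
      (by simpa only [Complex.ofReal_re] using hβT)).1
  -- the clean-scale claim: a violating `(D′, χ′, β′)` would be a second exceptional zero at level `D²`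
  intro D' _ χ' hD'1 hD'N hprim' β' hβ'lo hβ'1 hzero
  have hχ' : χ' ≠ 1 := ne_one_of_isPrimitive hprim' hD'1
  have hD'T : (D' : ℝ) ≤ (D : ℝ) ^ 2 := le_trans hD'N (le_trans hNη.le hDT)
  have hlogDN : θ / 2 * Real.log D ≤ Real.log N := by
    have := Real.log_le_log (by positivity) hDN
    rwa [Real.log_rpow hD0] at this
  have hβ'T : 1 - c / Real.log ((D : ℝ) ^ 2) < β' := by
    rw [hlogT]
    have h1 : c / 2 * θ / 4 / Real.log N ≤ c / 2 * θ / 4 / (θ / 2 * Real.log D) :=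
      div_le_div_of_nonneg_left (by positivity) (by positivity) hlogDN
    have h2 : c / 2 * θ / 4 / (θ / 2 * Real.log D) = c / (4 * Real.log D) := by
      field_simp
    have hgap : c / (2 * Real.log D) - c / (4 * Real.log D) = c / (4 * Real.log D) := by
      field_simp; ring
    have hpos : 0 < c / (4 * Real.log D) := by positivity
    linarith
  have hχ'sq : χ' ^ 2 = 1 :=
    (hreal D' χ' hχ' hD'T (β' : ℂ) hzero (by simp only [Complex.ofReal_im, abs_zero]; linarith)
      (by simpa only [Complex.ofReal_re] using hβ'T)).1
  obtain ⟨hDD', -, -⟩ :=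
    huniq D' D χ' χ hχ' hχ hprim' hprim hχ'sq hχsq hD'T hDT β' β hzero hβ0 hβ'T hβT
  have hlt : (D' : ℝ) < (D : ℝ) := lt_of_le_of_lt hD'N hNη
  rw [hDD'] at hlt
  exact lt_irrefl _ hlt

/-- Ledger check (propositional): with U-B and U-D now theorems, the §U chain's remaining inputs at node U
are U-A (deck 28, quantitative form landed), U-C (typed) and the crux clause U-E. -/
example : SmallLOneForcesRealZero ∧ DHWindowClean :=
  ⟨smallLOneForcesRealZero_holds, dhWindowClean_holds⟩

end Summit.Parity.GeneralizedHardyLittlewood.Theorems.PrimeLevelFamEdgeIdeaDeltas.ExcZeroLedgerWindow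

end
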